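import Summits.Ventures.CertifiedQuantumChemistry.Rows.FrozenCoreRelaxationEnergy
import Summits.Ventures.CertifiedQuantumChemistry.Rows.FrozenCoreRows
import HarnessLib

/-!
# Ventures/CertifiedQuantumChemistry — Rows/FrozenCoreRelaxationSector.lean: the `S_z`-sector DQG value
# of the full model lies below that of any frozen-core reduction

HONEST FRAMING (verbatim): certified bounds for a stated model Hamiltonian in a stated basis; not a
claim about the real molecule beyond that model.

Seat rdm-B (gen 22), file 7 (last) of the relaxation-level frozen-core set
(`Rows/FrozenCoreRelaxation{Pair,Blocks,Hole,ParticleHole,Feasible,Energy}.lean`). For the molecular frozen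
core `e = orbEmb φ`, `K = orbs C` (`φ : Λ ↪o Λ'` the active orbitals, `C ⊆ Λ'` the core, `φ x ∉ C`) the
`S_z`-SECTOR ROWS of Mazziotti (2007) §II.F (`IsDQGFeasibleSector`, `VariationalRDMRelaxation.lean`) are
transported: the `S_z` selection rule of `γ'`, the spin-resolved traces `Tr γ'_σσ = Tr γ_σσ + |C|`
(`sum_frozenOne_orb_diag`) and the traces of the `σσ` and `↑↓` blocks of `Γ'`
(`sum_frozenTwo_orb_sameSpin`: `+ 2|C| Tr γ_σσ + |C|(|C| − 1)`; `sum_frozenTwo_orb_upDown`: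
`+ |C| Tr γ_↑↑ + |C| Tr γ_↓↓ + |C|²`), whence **`isDQGFeasibleSector_frozen`**:
`IsDQGFeasibleSector a b γ Γ → IsDQGFeasibleSector (a + |C|) (b + |C|) γ' Γ'` (`a + b + 2 ≤ 2|Λ|`), and
THE RESULT **`pqgSectorEnergy_le_frozenCore`**:
`E_PQG(h, g, h_nuc; a + |C|, b + |C|) ≤ E_PQG(h^FC, g|_act, h_nuc + E_core; a, b)` for `a, b ≤ |Λ|`,
`a + b + 2 ≤ 2|Λ|`, with exactly the frozen-core tables of `sectorGroundEnergy_le_frozenCore`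
(`Literature/…/FrozenCoreHamiltonian.lean`) — its relaxation-level twin: at the DQG rung, as on the exact
side, an active-space (frozen-core) model is an INNER approximation of the full-basis model, so the
full model's sector relaxation value lies below the frozen-core one; nothing is claimed conversely (cf.
`Rows/FrozenCoreLowerRowsCounterexample.lean` on the exact side). All PROVED (0 sorry, no definition);
abstract programme values only — no row, no certificate, nothing about a deposited model. References:
D. A. Mazziotti, Adv. Chem. Phys. 134 (2007) ch. 3 §II.F eqs. (87)–(90) [Mazziotti2007RDMChapter];
T. Helgaker, P. Jørgensen, J. Olsen (2000) §12.5.1 [HelgakerJorgensenOlsen2000]; E. Koridon et al.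
(2021) App. A [KoridonEtAl2021].
-/

noncomputable section

namespace Summit.Ventures.CertifiedQuantumChemistry

open Matrix Finset
open Literature.MathematicalPhysics.QuantumLattice Literature.MathematicalPhysics.QuantumChemistry JWEmbed
open scoped ComplexOrder

/-! ## The `S_z`-sector rows of the molecular frozen core -/

section Sector

variable {Λ Λ' : Type*} [LinearOrder Λ] [Fintype Λ] [LinearOrder Λ'] [Fintype Λ']
variable (φ : Λ ↪o Λ') {C : Finset Λ'}

omit [Fintype Λ'] in
/-- Every orbital of the big basis is an active orbital `φ x` or lies outside the active range. -/
theorem range_cases (p : Λ') : (∃ x, φ x = p) ∨ (∀ x, φ x ≠ p) := by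
  by_cases h : ∃ x, φ x = p
  · exact Or.inl h
  · exact Or.inr fun x hx => h ⟨x, hx⟩

/-- An orbital outside `univ.map φ` is not an active orbital. -/
theorem ne_of_mem_compl_map {p : Λ'} (hp : p ∈ (Finset.univ.map φ.toEmbedding)ᶜ) (x : Λ) : φ x ≠ p :=
  fun hx => (Finset.mem_compl.1 hp) (Finset.mem_map.2 ⟨x, Finset.mem_univ _, hx⟩)

/-- The core lies outside the active range: `C ⊆ (univ.map φ)ᶜ`, so `(univ.map φ)ᶜ ∩ C = C`. -/
theorem compl_map_inter_core (hC : ∀ x, φ x ∉ C) : (Finset.univ.map φ.toEmbedding)ᶜ ∩ C = C := by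
  refine Finset.inter_eq_right.2 fun c hc => Finset.mem_compl.2 fun h => ?_
  obtain ⟨x, -, hx⟩ := Finset.mem_map.1 h
  exact hC x (hx ▸ hc)

variable (γ : Matrix (Orb Λ) (Orb Λ) ℂ) (Γ : Matrix (Orb Λ × Orb Λ) (Orb Λ × Orb Λ) ℂ)

/-- Spin-diagonal trace of the extended one-matrix: `Σ_y γ'_{(yσ),(yσ)} = Σ_x γ_{(xσ),(xσ)} + |C|`. -/
theorem sum_frozenOne_orb_diag (hC : ∀ x, φ x ∉ C) (σ : Fin 2) :
    ∑ y : Λ', frozenOne (orbEmb φ) (orbs C) γ (orb y σ) (orb y σ) =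
      ∑ x : Λ, γ (orb x σ) (orb x σ) + C.card := by
  have hK := disjoint_orbs_rangeF_orbEmb φ hC
  rw [sum_eq_sum_apply_add_sum_compl_range φ]
  congr 1
  · refine Finset.sum_congr rfl fun x _ => ?_
    rw [← orbEmb_orb, frozenOne_apply_apply _ γ hK]
  · rw [Finset.sum_congr rfl fun p hp => frozenOne_env_env (orbEmb φ) γ (K := orbs C)
      (orb_not_mem_rangeF_orbEmb φ (ne_of_mem_compl_map φ hp) σ) (m' := orb p σ)]
    simp only [true_and, orb_mem_orbs, Finset.sum_boole, Finset.filter_mem_eq_inter, compl_map_inter_core φ hC]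

/-- Diagonal pair sums of the extended two-matrix at equal spins:
`Σ_{y y'} Γ'_{(yσ, y'σ),(yσ, y'σ)} = Σ_{x x'} Γ_{…} + 2|C| Σ_x γ_{(xσ),(xσ)} + |C|(|C| − 1)`. -/
theorem sum_frozenTwo_orb_sameSpin (hC : ∀ x, φ x ∉ C) (σ : Fin 2) :
    ∑ y : Λ', ∑ y' : Λ', frozenTwo (orbEmb φ) (orbs C) γ Γ (orb y σ, orb y' σ) (orb y σ, orb y' σ) =
      ∑ x : Λ, ∑ x' : Λ, Γ (orb x σ, orb x' σ) (orb x σ, orb x' σ) +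
        2 * C.card * ∑ x : Λ, γ (orb x σ) (orb x σ) + C.card * (C.card - 1) := by
  have hK := disjoint_orbs_rangeF_orbEmb φ hC
  have hCS := compl_map_inter_core φ hC
  rw [sum_eq_sum_apply_add_sum_compl_range φ]
  have hA : ∀ x : Λ, ∑ y' : Λ', frozenTwo (orbEmb φ) (orbs C) γ Γ (orb (φ x) σ, orb y' σ) (orb (φ x) σ, orb y' σ) =
      ∑ x' : Λ, Γ (orb x σ, orb x' σ) (orb x σ, orb x' σ) + C.card * γ (orb x σ) (orb x σ) := by
    intro x
    rw [sum_eq_sum_apply_add_sum_compl_range φ]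
    congr 1
    · refine Finset.sum_congr rfl fun x' _ => ?_
      rw [← orbEmb_orb, ← orbEmb_orb, frozenTwo_active _ γ Γ hK]
    · rw [Finset.sum_congr rfl fun p hp => by
        rw [← orbEmb_orb, frozenTwo_IEIE (orbEmb φ) γ Γ hK _ _ (K := orbs C)
          (orb_not_mem_rangeF_orbEmb φ (ne_of_mem_compl_map φ hp) σ) (m' := orb p σ)]]
      simp only [true_and, orb_mem_orbs, Finset.sum_ite_mem, hCS, Finset.sum_const, nsmul_eq_mul]
  have hE : ∀ p : Λ', p ∈ (Finset.univ.map φ.toEmbedding)ᶜ →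
      ∑ y' : Λ', frozenTwo (orbEmb φ) (orbs C) γ Γ (orb p σ, orb y' σ) (orb p σ, orb y' σ) =
        (if p ∈ C then ∑ x : Λ, γ (orb x σ) (orb x σ) else 0) +
          if p ∈ C then ((C.card : ℂ) - 1) else 0 := by
    intro p hp
    have hpσ := orb_not_mem_rangeF_orbEmb φ (ne_of_mem_compl_map φ hp) σ
    rw [sum_eq_sum_apply_add_sum_compl_range φ]
    congr 1
    · rw [Finset.sum_congr rfl fun x' _ => by
        rw [← orbEmb_orb, frozenTwo_EIEI (orbEmb φ) γ Γ hK _ _ (K := orbs C) hpσ (m' := orb p σ)]]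
      simp only [true_and, orb_mem_orbs, Finset.sum_ite_irrel, Finset.sum_const_zero]
    · rw [Finset.sum_congr rfl fun q hq => by
        rw [frozenTwo_env (orbEmb φ) γ Γ (K := orbs C) hpσ
          (orb_not_mem_rangeF_orbEmb φ (ne_of_mem_compl_map φ hq) σ) (orb p σ) (orb q σ)]]
      have hiff : ∀ q : Λ', (p = q ∧ q = p) ↔ p = q := fun q => ⟨And.left, fun h => ⟨h, h.symm⟩⟩
      simp only [orb_mem_orbs, orb_eq_orb_iff, and_true, hiff, ite_and, Finset.sum_ite_mem, hCS,
        Finset.sum_ite_irrel, Finset.sum_sub_distrib, Finset.sum_const, nsmul_eq_mul, mul_one,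
        Finset.sum_ite_eq]
      by_cases hpC : p ∈ C <;> simp [hpC]
  rw [Finset.sum_congr rfl fun x _ => hA x, Finset.sum_congr rfl fun p hp => hE p hp]
  simp only [Finset.sum_add_distrib, Finset.sum_ite_mem, hCS, Finset.sum_const, nsmul_eq_mul, ← Finset.mul_sum]
  ring

/-- Diagonal pair sums of the extended two-matrix at opposite spins:
`Σ_{y y'} Γ'_{(y↑, y'↓),(y↑, y'↓)} = Σ_{x x'} Γ_{…} + |C| (Σ_x γ_{x↑,x↑} + Σ_x γ_{x↓,x↓}) + |C|²`. -/
theorem sum_frozenTwo_orb_upDown (hC : ∀ x, φ x ∉ C) :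
    ∑ y : Λ', ∑ y' : Λ', frozenTwo (orbEmb φ) (orbs C) γ Γ (orb y 0, orb y' 1) (orb y 0, orb y' 1) =
      ∑ x : Λ, ∑ x' : Λ, Γ (orb x 0, orb x' 1) (orb x 0, orb x' 1) +
        C.card * ∑ x : Λ, γ (orb x 0) (orb x 0) + C.card * ∑ x : Λ, γ (orb x 1) (orb x 1) + C.card * C.card := by
  have hK := disjoint_orbs_rangeF_orbEmb φ hC
  have hCS := compl_map_inter_core φ hC
  rw [sum_eq_sum_apply_add_sum_compl_range φ]
  have hA : ∀ x : Λ, ∑ y' : Λ', frozenTwo (orbEmb φ) (orbs C) γ Γ (orb (φ x) 0, orb y' 1) (orb (φ x) 0, orb y' 1) =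
      ∑ x' : Λ, Γ (orb x 0, orb x' 1) (orb x 0, orb x' 1) + C.card * γ (orb x 0) (orb x 0) := by
    intro x
    rw [sum_eq_sum_apply_add_sum_compl_range φ]
    congr 1
    · refine Finset.sum_congr rfl fun x' _ => ?_
      rw [← orbEmb_orb, ← orbEmb_orb, frozenTwo_active _ γ Γ hK]
    · rw [Finset.sum_congr rfl fun p hp => by
        rw [← orbEmb_orb, frozenTwo_IEIE (orbEmb φ) γ Γ hK _ _ (K := orbs C)
          (orb_not_mem_rangeF_orbEmb φ (ne_of_mem_compl_map φ hp) 1) (m' := orb p 1)]]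
      simp only [true_and, orb_mem_orbs, Finset.sum_ite_mem, hCS, Finset.sum_const, nsmul_eq_mul]
  have hE : ∀ p : Λ', p ∈ (Finset.univ.map φ.toEmbedding)ᶜ →
      ∑ y' : Λ', frozenTwo (orbEmb φ) (orbs C) γ Γ (orb p 0, orb y' 1) (orb p 0, orb y' 1) =
        (if p ∈ C then ∑ x : Λ, γ (orb x 1) (orb x 1) else 0) + if p ∈ C then (C.card : ℂ) else 0 := by
    intro p hp
    have hp0 := orb_not_mem_rangeF_orbEmb φ (ne_of_mem_compl_map φ hp) 0
    rw [sum_eq_sum_apply_add_sum_compl_range φ]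
    congr 1
    · rw [Finset.sum_congr rfl fun x' _ => by
        rw [← orbEmb_orb, frozenTwo_EIEI (orbEmb φ) γ Γ hK _ _ (K := orbs C) hp0 (m' := orb p 0)]]
      simp only [true_and, orb_mem_orbs, Finset.sum_ite_irrel, Finset.sum_const_zero]
    · rw [Finset.sum_congr rfl fun q hq => by
        rw [frozenTwo_env (orbEmb φ) γ Γ (K := orbs C) hp0
          (orb_not_mem_rangeF_orbEmb φ (ne_of_mem_compl_map φ hq) 1) (orb p 0) (orb q 1)]]
      simp only [orb_mem_orbs, orb_eq_orb_iff, zero_ne_one, and_false, false_and, and_true, if_false,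
        sub_zero, ite_and, Finset.sum_ite_mem, hCS, Finset.sum_ite_irrel, Finset.sum_const, nsmul_eq_mul,
        mul_one]
      by_cases hpC : p ∈ C <;> simp [hpC]
  rw [Finset.sum_congr rfl fun x _ => hA x, Finset.sum_congr rfl fun p hp => hE p hp]
  simp only [Finset.sum_add_distrib, Finset.sum_ite_mem, hCS, Finset.sum_const, nsmul_eq_mul, ← Finset.mul_sum]
  ring

/-- **SECTOR FEASIBILITY TRANSPORTS ALONG THE MOLECULAR FROZEN CORE**: if `(γ, Γ)` is feasible for the
`(N_α, N_β) = (a, b)` sector DQG programme of the active orbitals with `a + b + 2 ≤ 2|Λ|`, then the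
extended pair is feasible for the `(a + |C|, b + |C|)` sector programme of the full basis. -/
theorem isDQGFeasibleSector_frozen (hC : ∀ x, φ x ∉ C) {a b : ℕ} (hs : IsDQGFeasibleSector a b γ Γ)
    (hr : a + b + 2 ≤ 2 * Fintype.card Λ) :
    IsDQGFeasibleSector (a + C.card) (b + C.card) (frozenOne (orbEmb φ) (orbs C) γ)
      (frozenTwo (orbEmb φ) (orbs C) γ Γ) where
  dqg := by
    have h := isDQGFeasible_frozen (orbEmb φ) γ Γ (disjoint_orbs_rangeF_orbEmb φ hC) hs.dqg
      (by rw [card_orb]; omega)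
    rw [card_orbs] at h
    have e : a + C.card + (b + C.card) = a + b + 2 * C.card := by ring
    rw [e]
    exact h
  spin_sel p q σ τ hστ := by
    have hK := disjoint_orbs_rangeF_orbEmb φ hC
    rcases range_cases φ p with ⟨x, rfl⟩ | hp <;> rcases range_cases φ q with ⟨y, rfl⟩ | hq
    · rw [← orbEmb_orb, ← orbEmb_orb, frozenOne_apply_apply _ γ hK]
      exact hs.spin_sel x y σ τ hστ
    · rw [← orbEmb_orb]
      exact frozenOne_apply_env _ γ (orb_not_mem_rangeF_orbEmb φ hq τ) _
    · rw [← orbEmb_orb]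
      exact frozenOne_env_apply _ γ (orb_not_mem_rangeF_orbEmb φ hp σ) _
    · rw [frozenOne_env_env _ γ (orb_not_mem_rangeF_orbEmb φ hp σ)]
      simp only [orb_eq_orb_iff, hστ, and_false, false_and, if_false]
  trace_up := by
    rw [sum_frozenOne_orb_diag φ γ hC 0, hs.trace_up, Nat.cast_add]
  trace_down := by
    rw [sum_frozenOne_orb_diag φ γ hC 1, hs.trace_down, Nat.cast_add]
  trace_upUp := by
    rw [sum_frozenTwo_orb_sameSpin φ γ Γ hC 0, hs.trace_upUp, hs.trace_up, Nat.cast_add]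
    ring
  trace_downDown := by
    rw [sum_frozenTwo_orb_sameSpin φ γ Γ hC 1, hs.trace_downDown, hs.trace_down, Nat.cast_add]
    ring
  trace_upDown := by
    rw [sum_frozenTwo_orb_upDown φ γ Γ hC, hs.trace_upDown, hs.trace_up, hs.trace_down, Nat.cast_add, Nat.cast_add]
    ring

/-- **THE SECTOR DQG VALUE OF THE FULL MODEL LIES BELOW THAT OF ANY FROZEN-CORE REDUCTION**:
`E_PQG(h, g, h_nuc; a + |C|, b + |C|) ≤ E_PQG(h^FC, g|_act, h_nuc + E_core; a, b)` for every non-trivial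
active sector `a, b ≤ |Λ|` with `a + b + 2 ≤ 2|Λ|` — the relaxation-level twin of
`sectorGroundEnergy_le_frozenCore` (same frozen-core tables). -/
theorem pqgSectorEnergy_le_frozenCore (hC : ∀ x, φ x ∉ C) (h : Λ' → Λ' → ℂ)
    (g : Λ' → Λ' → Λ' → Λ' → ℂ) (hnuc : ℂ) {a b : ℕ} (ha : a ≤ Fintype.card Λ) (hb : b ≤ Fintype.card Λ)
    (hr : a + b + 2 ≤ 2 * Fintype.card Λ) :
    pqgSectorEnergy h g hnuc (a + C.card) (b + C.card) ≤
      pqgSectorEnergy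
        (fun x y => h (φ x) (φ y) + ∑ c ∈ C, (g (φ x) (φ y) c c + g c c (φ x) (φ y)) -
          (1 / 2 : ℂ) * ∑ c ∈ C, (g (φ x) c c (φ y) + g c (φ y) (φ x) c))
        (fun x y z w => g (φ x) (φ y) (φ z) (φ w))
        (hnuc + (2 * ∑ c ∈ C, h c c + ∑ c ∈ C, ∑ d ∈ C, (2 * g c c d d - g c d d c))) a b := by
  refine le_csInf (pqgSectorEnergySet_nonempty _ _ _ ha hb) ?_
  rintro E ⟨γ, Γ, hf, rfl⟩
  rw [← rdmEnergy_frozen φ h g hnuc γ Γ]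
  exact pqgSectorEnergy_le_rdmEnergy h g hnuc (isDQGFeasibleSector_frozen φ γ Γ hC hf hr)

end Sector

end Summit.Ventures.CertifiedQuantumChemistry

end
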